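import Literature.Analysis.FluidPDE.ElgindiHalfPiIdentities
import Literature.Analysis.FluidPDE.ElgindiThetaZeroRegularity
import HarnessLib

/-!
# The degenerate end `θ = π/2`: estimates, the vanishing flux `P_k(R,0⁺) = 0`, and continuity up
# to `σ = 0` of `z_k = V_k/cos θ` and `∂_σz_k` ([Elgindi2021] §7.1 Proposition 7.1)

Topic `Literature/Analysis/FluidPDE`. Support file (definitions with bodies and proved theorems, no
named facts) on the proof path of the named fact
`Literature.Analysis.FluidPDE.Elgindi.ElgindiGhoulMasmoudi2021_stabilityCore`
(`ElgindiStabilityDecomposition.lean`). T. M. Elgindi, Ann. of Math. 194 (2021) =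
arXiv:1904.04795, §7.1 Proposition 7.1 (p. 19 of the held text).

In the reflected variable `σ = π/2 − θ` (`ElgindiHalfPiIdentities.lean`): the slices `w_k(R,·)`
tend to `0` at `σ = 0⁺` at the uniform rate `√σ` and `∂_σw_k ∈ L²` slice by slice; the flux
`P_k = sin²σ∂_σw_k − sin σcos σw_k` has a limit at `0⁺`, which must vanish because
`∂_σw_k ∈ L²` (`tendsto_pRefl_zero`); hence `P_k(R,σ) = −∫₀^σ sin²t·n_k(R,t) dt`
(`pRefl_eq_integral`), `J_k := −P_k/σ³ = M₂[sinc²·n_k]` (`jRefl_eq_avgM`), `∂_σz_k = −(σ/sin σ)³J_k`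
with `|∂_σz_k| ≤ K` uniformly on compact radial ranges, and `w_k, n_k, J_k, ∂_σz_k, z_k` all extend
jointly continuously to `σ = 0` (`extZero_wRefl`, …, `extZero_zRefl`).
-/

noncomputable section

open MeasureTheory Set Real Filter Function intervalIntegral
open _root_.Topology
open scoped ContDiff

namespace Literature.Analysis.FluidPDE

namespace Elgindi

/-- `J_k = −P_k/σ³`. [folklore] -/
def jRefl (Ψ : ℝ → ℝ → ℝ) (k : ℕ) : ℝ → ℝ → ℝ := fun R σ => -pRefl Ψ k R σ / σ ^ 3

/-- `r_k = sinc²σ·n_k`. [folklore] -/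
def rRefl (α : ℝ) (f Ψ : ℝ → ℝ → ℝ) (k : ℕ) : ℝ → ℝ → ℝ := fun R σ => Real.sinc σ ^ 2 * nRefl α f Ψ k R σ

/-- The reflection `σ ↦ π/2 − σ` maps `𝓝[>] 0` to `𝓝[<] (π/2)`. [folklore] -/
theorem tendsto_pi_div_two_sub : Tendsto (fun σ : ℝ => π / 2 - σ) (𝓝[>] 0) (𝓝[<] (π / 2)) := by
  refine tendsto_nhdsWithin_iff.2 ⟨?_, ?_⟩
  · have : Tendsto (fun σ : ℝ => π / 2 - σ) (𝓝 0) (𝓝 (π / 2 - 0)) := tendsto_const_nhds.sub tendsto_id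
    rw [sub_zero] at this
    exact this.mono_left nhdsWithin_le_nhds
  · filter_upwards [self_mem_nhdsWithin] with σ hσ
    show π / 2 - σ < π / 2
    have : (0:ℝ) < σ := hσ
    linarith

/-- `sin σ > 0` on `(0, π/2)`. [folklore] -/
theorem sin_pos_of_mem {σ : ℝ} (hσ : σ ∈ Ioo 0 (π / 2)) : 0 < Real.sin σ :=
  Real.sin_pos_of_pos_of_lt_pi hσ.1 (by linarith [hσ.2, Real.pi_pos])

/-- Jordan: `(σ/sin σ)³ ≤ (π/2)³` on `(0, π/2)`. [folklore] -/
theorem div_sin_pow_three_le {σ : ℝ} (hσ : σ ∈ Ioo 0 (π / 2)) : (σ / Real.sin σ) ^ 3 ≤ (π / 2) ^ 3 := by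
  have hs := sin_pos_of_mem hσ
  have hJ := Real.mul_le_sin hσ.1.le hσ.2.le
  have h1 : σ / Real.sin σ ≤ π / 2 := by
    rw [div_le_iff₀ hs]
    have := mul_le_mul_of_nonneg_left hJ (by positivity : (0:ℝ) ≤ π / 2)
    calc σ = π / 2 * (2 / π * σ) := by field_simp
      _ ≤ π / 2 * Real.sin σ := this
  exact pow_le_pow_left₀ (div_nonneg hσ.1.le hs.le) h1 3

namespace TangentialFamily

variable {α : ℝ} {f Ψ : ℝ → ℝ → ℝ} (h : TangentialFamily α f Ψ)
include h

/-! ### Slices of `w_k` -/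

/-- `w_k(R,σ) → 0` as `σ → 0⁺`. [folklore] -/
theorem tendsto_wRefl_zero (k : ℕ) {R : ℝ} (hR : 0 < R) : Tendsto (fun σ => wRefl Ψ k R σ) (𝓝[>] 0) (𝓝 0) :=
  ((h.slice k hR).2.2.2).comp tendsto_pi_div_two_sub

/-- **Uniform rate `|w_k(R,σ)| ≤ S√σ` on `R ∈ [a,b]`.** [folklore] -/
theorem wRefl_rate (k : ℕ) {a b : ℝ} (ha : 0 < a) (hab : a < b) :
    ∃ S : ℝ, 0 ≤ S ∧ ∀ R ∈ Icc a b, ∀ σ ∈ Ioo 0 (π / 2), |wRefl Ψ k R σ - 0| ≤ S * Real.sqrt σ := by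
  obtain ⟨S, hS0, hS⟩ := h.sq_le_near_boundary k ha hab
  refine ⟨Real.sqrt S, Real.sqrt_nonneg _, fun R hR σ hσ => ?_⟩
  rw [sub_zero]
  have hθ : π / 2 - σ ∈ Ioo 0 (π / 2) := ⟨by linarith [hσ.2], by linarith [hσ.1]⟩
  have h2 := (hS R hR (π / 2 - σ) hθ).2
  rw [show π / 2 - (π / 2 - σ) = σ by ring] at h2
  have : wRefl Ψ k R σ ^ 2 ≤ (Real.sqrt S * Real.sqrt σ) ^ 2 := by
    rw [mul_pow, Real.sq_sqrt hS0, Real.sq_sqrt hσ.1.le]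
    show (Dz^[k] Ψ) R (π / 2 - σ) ^ 2 ≤ S * σ
    linarith
  exact abs_le_of_sq_le_sq this (by positivity)

/-- **Uniform bound `|w_k| ≤ B` on `[a,b] × (0,π/2)`.** [folklore] -/
theorem wRefl_bound (k : ℕ) {a b : ℝ} (ha : 0 < a) (hab : a < b) :
    ∃ B : ℝ, 0 ≤ B ∧ ∀ R ∈ Icc a b, ∀ σ ∈ Ioo 0 (π / 2), |wRefl Ψ k R σ| ≤ B := by
  obtain ⟨S, hS0, hS⟩ := h.wRefl_rate k ha hab
  refine ⟨S * Real.sqrt (π / 2), by positivity, fun R hR σ hσ => ?_⟩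
  have := hS R hR σ hσ
  rw [sub_zero] at this
  exact this.trans (mul_le_mul_of_nonneg_left (Real.sqrt_le_sqrt hσ.2.le) hS0)

/-- **`∂_σw_k ∈ L²(0,π/2)` slice by slice, uniformly on `[a,b]`.** [folklore] -/
theorem dθ_wRefl_sq_slice (k : ℕ) {a b : ℝ} (ha : 0 < a) (hab : a < b) :
    ∃ T : ℝ, 0 ≤ T ∧ ∀ R ∈ Icc a b,
      IntegrableOn (fun σ => dθ (wRefl Ψ k) R σ ^ 2) (Ioo 0 (π / 2)) ∧ (∫ σ in Ioo 0 (π / 2), dθ (wRefl Ψ k) R σ ^ 2) ≤ T := by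
  obtain ⟨T, hT0, hT⟩ := h.slice_sq_bounds k ha hab
  refine ⟨T, hT0, fun R hR => ?_⟩
  obtain ⟨-, -, iY, bY⟩ := hT R hR
  have hmp : MeasurePreserving (fun s : ℝ => π / 2 - s) volume volume := volume.measurePreserving_sub_left (π / 2)
  have hme : MeasurableEmbedding fun s : ℝ => π / 2 - s := measurableEmbedding_subLeft (π / 2)
  have hpre : (fun s : ℝ => π / 2 - s) ⁻¹' Ioo 0 (π / 2) = Ioo 0 (π / 2) := by
    ext s; simp only [mem_preimage, mem_Ioo]; constructor <;> intro hs <;> constructor <;> linarith [hs.1, hs.2]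
  have e : (fun σ => dθ (wRefl Ψ k) R σ ^ 2) = (fun θ => dθ (Dz^[k] Ψ) R θ ^ 2) ∘ fun s : ℝ => π / 2 - s := by
    funext σ; simp only [Function.comp, wRefl, dθ_refl, neg_sq]
  rw [e]
  constructor
  · have := (hmp.integrableOn_comp_preimage hme (f := fun θ => dθ (Dz^[k] Ψ) R θ ^ 2) (s := Ioo 0 (π / 2))).2 iY
    rwa [hpre] at this
  · have := hmp.setIntegral_preimage_emb hme (fun θ => dθ (Dz^[k] Ψ) R θ ^ 2) (Ioo 0 (π / 2))
    rw [hpre] at this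
    show (∫ s in Ioo 0 (π / 2), (fun θ => dθ (Dz^[k] Ψ) R θ ^ 2) (π / 2 - s)) ≤ T
    rw [this]; exact bY

/-! ### Bounds for `n_k` -/

/-- **`|n_k| ≤ N` uniformly on `[a,b] × (0,π/2)`.** [folklore] -/
theorem nRefl_bound (k : ℕ) {a b : ℝ} (ha : 0 < a) (hab : a < b) :
    ∃ N : ℝ, 0 ≤ N ∧ ∀ R ∈ Icc a b, ∀ σ ∈ Ioo 0 (π / 2), |nRefl α f Ψ k R σ| ≤ N := by
  obtain ⟨B₀, hB₀0, hB₀⟩ := h.wRefl_bound k ha hab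
  obtain ⟨B₁, hB₁0, hB₁⟩ := h.wRefl_bound (k + 1) ha hab
  obtain ⟨B₂, hB₂0, hB₂⟩ := h.wRefl_bound (k + 2) ha hab
  obtain ⟨C, hC⟩ := h.datum_bound k
  have hC0 : 0 ≤ C := (abs_nonneg _).trans (hC (1, 1))
  refine ⟨4 * B₀ + C + α ^ 2 * (B₂ + B₁) + |α * (5 + α)| * B₁, by positivity, fun R hR σ hσ => ?_⟩
  have h0 := hB₀ R hR σ hσ; have h1 := hB₁ R hR σ hσ; have h2 := hB₂ R hR σ hσ
  have hd : |refl (Dz^[k] f) R σ| ≤ C := hC (R, π / 2 - σ)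
  unfold nRefl
  calc |4 * wRefl Ψ k R σ + refl (Dz^[k] f) R σ + α ^ 2 * (wRefl Ψ (k + 2) R σ - wRefl Ψ (k + 1) R σ) + α * (5 + α) * wRefl Ψ (k + 1) R σ|
      ≤ |4 * wRefl Ψ k R σ| + |refl (Dz^[k] f) R σ| + |α ^ 2 * (wRefl Ψ (k + 2) R σ - wRefl Ψ (k + 1) R σ)| + |α * (5 + α) * wRefl Ψ (k + 1) R σ| := by
        refine (abs_add_le _ _).trans ?_
        gcongr
        refine (abs_add_le _ _).trans ?_
        gcongr
        exact abs_add_le _ _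
    _ ≤ 4 * B₀ + C + α ^ 2 * (B₂ + B₁) + |α * (5 + α)| * B₁ := by
        gcongr
        · rw [abs_mul, show |(4:ℝ)| = 4 by norm_num]; gcongr
        · rw [abs_mul, abs_of_nonneg (sq_nonneg α)]; gcongr; exact (abs_sub _ _).trans (add_le_add h2 h1)
        · rw [abs_mul]; gcongr

/-! ### The flux `P_k` vanishes at `σ = 0` -/

/-- `x ↦ x⁻⁴` is not integrable at `0⁺`. [folklore] -/
theorem not_integrableOn_inv_pow_four {t : ℝ} (ht : 0 < t) : ¬IntegrableOn (fun x : ℝ => x ^ (-4:ℝ)) (Ioo 0 t) := by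
  have := h
  rw [intervalIntegral.integrableOn_Ioo_rpow_iff ht]; norm_num

set_option maxHeartbeats 800000 in
/-- **`P_k(R,σ) → 0` as `σ → 0⁺`**: the limit exists (`∂_σP_k` is bounded) and a nonzero limit would
force `∂_σw_k ∉ L²`. [cite: Elgindi2021, §7.1 Proposition 7.1 (p. 19 of arXiv:1904.04795)] -/
theorem tendsto_pRefl_zero (k : ℕ) {R : ℝ} (hR : 0 < R) : Tendsto (fun σ => pRefl Ψ k R σ) (𝓝[>] 0) (𝓝 0) := by
  have ha : 0 < R / 2 := by positivity
  have hab : R / 2 < 2 * R := by linarith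
  have hRI : R ∈ Icc (R / 2) (2 * R) := ⟨by linarith, by linarith⟩
  obtain ⟨N, hN0, hN⟩ := h.nRefl_bound k ha hab
  obtain ⟨T, -, hT⟩ := h.dθ_wRefl_sq_slice k ha hab
  obtain ⟨iW, -⟩ := hT R hRI
  have hπ2 : (0:ℝ) < π / 2 := by positivity
  -- the limit of `P` exists
  have hy : ∀ σ ∈ Ioo (0:ℝ) (π / 2), HasDerivAt (fun σ' => pRefl Ψ k R σ') (dθ (pRefl Ψ k) R σ) σ := fun σ hσ =>
    h.hasDerivAt_sigma (h.smooth_pRefl k) (p := (R, σ)) ⟨hR, hσ⟩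
  have hy'c : ContinuousOn (fun σ => dθ (pRefl Ψ k) R σ) (Ioo 0 (π / 2)) :=
    h.continuousOn_theta_slice (contDiffOn_dθ_strip (h.smooth_pRefl k)) hR
  have hbd : ∀ σ ∈ Ioo (0:ℝ) (π / 2), |dθ (pRefl Ψ k) R σ| ≤ N := fun σ hσ => by
    rw [h.dθ_pRefl_eq k (p := (R, σ)) ⟨hR, hσ⟩]
    show |-Real.sin σ ^ 2 * nRefl α f Ψ k R σ| ≤ N
    rw [abs_mul, abs_neg, abs_of_nonneg (sq_nonneg _)]
    have hs1 : Real.sin σ ^ 2 ≤ 1 := by nlinarith [Real.sin_sq_add_cos_sq σ, sq_nonneg (Real.cos σ)]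
    calc Real.sin σ ^ 2 * |nRefl α f Ψ k R σ| ≤ 1 * N := mul_le_mul hs1 (hN R hRI σ hσ) (abs_nonneg _) zero_le_one
      _ = N := one_mul N
  have hI : IntegrableOn (fun σ => dθ (pRefl Ψ k) R σ ^ 2) (Ioo 0 (π / 2)) := by
    refine Integrable.mono' (integrableOn_const (by simp) : IntegrableOn (fun _ => N ^ 2) (Ioo (0:ℝ) (π / 2)) volume)
      ((hy'c.pow 2).aestronglyMeasurable measurableSet_Ioo) ?_
    rw [ae_restrict_iff' measurableSet_Ioo]
    refine ae_of_all _ fun σ hσ => ?_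
    rw [Real.norm_eq_abs, abs_of_nonneg (sq_nonneg _), ← sq_abs]
    exact pow_le_pow_left₀ (abs_nonneg _) (hbd σ hσ) 2
  obtain ⟨-, ⟨L, hL⟩⟩ := exists_tendsto_of_sq_integrable_deriv hπ2 hy hy'c hI
  -- suppose `L ≠ 0`
  suffices hL0 : L = 0 by rwa [hL0] at hL
  by_contra hne
  have hL4 : 0 < |L| / 4 := by positivity
  -- eventually `|P| ≥ |L|/2` and `|w| ≤ |L|/4`
  have hev1 : ∀ᶠ σ in 𝓝[>] (0:ℝ), |L| / 2 ≤ |pRefl Ψ k R σ| := by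
    have := (Metric.tendsto_nhds.1 hL) (|L| / 2) (by positivity)
    filter_upwards [this] with σ hσ
    rw [Real.dist_eq] at hσ
    have := abs_sub_abs_le_abs_sub L (pRefl Ψ k R σ)
    rw [abs_sub_comm] at this
    linarith
  have hev2 : ∀ᶠ σ in 𝓝[>] (0:ℝ), |wRefl Ψ k R σ| ≤ |L| / 4 := by
    have := (Metric.tendsto_nhds.1 (h.tendsto_wRefl_zero k hR)) (|L| / 4) hL4
    filter_upwards [this] with σ hσ
    rw [Real.dist_eq, sub_zero] at hσ; exact hσ.le
  obtain ⟨δ, hδ, hδsub⟩ := (mem_nhdsGT_iff_exists_Ioo_subset).1 ((hev1.and hev2).and (Ioo_mem_nhdsGT hπ2))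
  have hδ0 : 0 < δ := hδ
  -- on `(0, δ)`: `|∂_σw| ≥ |L|/(4σ²)`, so `(∂_σw)² ≥ L²/16·σ⁻⁴`
  have hdom : ∀ σ ∈ Ioo 0 δ, L ^ 2 / 16 * σ ^ (-4:ℝ) ≤ dθ (wRefl Ψ k) R σ ^ 2 := by
    intro σ hσ
    obtain ⟨⟨hP, hw⟩, hσπ⟩ := hδsub hσ
    have hs := sin_pos_of_mem hσπ
    have hsσ : Real.sin σ ≤ σ := Real.sin_le hσ.1.le
    have hc1 : |Real.cos σ| ≤ 1 := Real.abs_cos_le_one σ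
    -- `sin²|w'| ≥ |P| − sin|cos||w| ≥ |L|/2 − |L|/4`
    have hPdef : pRefl Ψ k R σ = Real.sin σ ^ 2 * dθ (wRefl Ψ k) R σ - Real.sin σ * Real.cos σ * wRefl Ψ k R σ := rfl
    have hs1 : Real.sin σ ≤ 1 := Real.sin_le_one σ
    have h1 : |L| / 4 ≤ Real.sin σ ^ 2 * |dθ (wRefl Ψ k) R σ| := by
      have htri : |pRefl Ψ k R σ| ≤ Real.sin σ ^ 2 * |dθ (wRefl Ψ k) R σ| + Real.sin σ * |Real.cos σ| * |wRefl Ψ k R σ| := by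
        rw [hPdef]
        calc |Real.sin σ ^ 2 * dθ (wRefl Ψ k) R σ - Real.sin σ * Real.cos σ * wRefl Ψ k R σ|
            ≤ |Real.sin σ ^ 2 * dθ (wRefl Ψ k) R σ| + |Real.sin σ * Real.cos σ * wRefl Ψ k R σ| := abs_sub _ _
          _ = _ := by rw [abs_mul, abs_of_nonneg (sq_nonneg _), abs_mul, abs_mul, abs_of_pos hs]
      have h2 : Real.sin σ * |Real.cos σ| * |wRefl Ψ k R σ| ≤ 1 * 1 * (|L| / 4) := by
        gcongr
      linarith
    have e : σ ^ (-4:ℝ) = 1 / σ ^ 4 := by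
      rw [Real.rpow_neg hσ.1.le, show (4:ℝ) = (4:ℕ) by norm_num, Real.rpow_natCast, one_div]
    rw [e]
    have hσ4 : 0 < σ ^ 4 := pow_pos hσ.1 4
    rw [div_mul_div_comm, mul_one, div_le_iff₀ (by positivity)]
    -- from `h1`: `|L|/4 ≤ sin²|w'| ≤ σ²|w'|`
    have h3 : |L| / 4 ≤ σ ^ 2 * |dθ (wRefl Ψ k) R σ| :=
      h1.trans (mul_le_mul_of_nonneg_right (pow_le_pow_left₀ hs.le hsσ 2) (abs_nonneg _))
    have h4 : (|L| / 4) ^ 2 ≤ (σ ^ 2 * |dθ (wRefl Ψ k) R σ|) ^ 2 := pow_le_pow_left₀ (by positivity) h3 2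
    rw [div_pow, mul_pow, sq_abs, sq_abs] at h4
    nlinarith [h4]
  have hIδ : IntegrableOn (fun σ : ℝ => L ^ 2 / 16 * σ ^ (-4:ℝ)) (Ioo 0 δ) := by
    have hδπ : Ioo 0 δ ⊆ Ioo 0 (π / 2) := fun σ hσ => (hδsub hσ).2 |> fun h => ⟨hσ.1, h.2⟩
    refine Integrable.mono' (iW.mono_set hδπ) ?_ ?_
    · exact ((measurable_id.pow_const _).const_mul _).aestronglyMeasurable
    · rw [ae_restrict_iff' measurableSet_Ioo]
      refine ae_of_all _ fun σ hσ => ?_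
      rw [Real.norm_eq_abs, abs_of_nonneg (by have := Real.rpow_nonneg hσ.1.le (-4:ℝ); positivity)]
      exact hdom σ hσ
  have hLu : IsUnit (L ^ 2 / 16) := isUnit_iff_ne_zero.2 (by positivity)
  exact not_integrableOn_inv_pow_four h hδ0 ((integrable_const_mul_iff hLu _).1 hIδ)

/-! ### The representation `P_k = −∫₀^σ sin²t·n_k` and `J_k = M₂[sinc²·n_k]` -/

/-- The integrand `t ↦ sin²t·n_k(R,t)` is continuous on `(0,π/2)` and bounded; it is integrable on
every `(0, σ]`. [folklore] -/
theorem intervalIntegrable_sin_sq_nRefl (k : ℕ) {R : ℝ} (hR : 0 < R) {σ : ℝ} (hσ : σ ∈ Ioo 0 (π / 2)) :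
    IntervalIntegrable (fun t => Real.sin t ^ 2 * nRefl α f Ψ k R t) volume 0 σ := by
  have ha : 0 < R / 2 := by positivity
  obtain ⟨N, -, hN⟩ := h.nRefl_bound k ha (by linarith : R / 2 < 2 * R)
  have hRI : R ∈ Icc (R / 2) (2 * R) := ⟨by linarith, by linarith⟩
  have hc : ContinuousOn (fun t => Real.sin t ^ 2 * nRefl α f Ψ k R t) (Ioo 0 (π / 2)) :=
    ((Real.continuous_sin.pow 2).continuousOn).mul (h.continuousOn_theta_slice (h.smooth_nRefl k) hR)
  rw [intervalIntegrable_iff_integrableOn_Ioo_of_le hσ.1.le]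
  have hsub : Ioo 0 σ ⊆ Ioo 0 (π / 2) := Ioo_subset_Ioo le_rfl hσ.2.le
  refine Integrable.mono' (integrableOn_const (by simp) : IntegrableOn (fun _ => N) (Ioo (0:ℝ) σ) volume)
    ((hc.mono hsub).aestronglyMeasurable measurableSet_Ioo) ?_
  rw [ae_restrict_iff' measurableSet_Ioo]
  refine ae_of_all _ fun t ht => ?_
  rw [Real.norm_eq_abs, abs_mul, abs_of_nonneg (sq_nonneg _)]
  have hs1 : Real.sin t ^ 2 ≤ 1 := by nlinarith [Real.sin_sq_add_cos_sq t, sq_nonneg (Real.cos t)]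
  calc Real.sin t ^ 2 * |nRefl α f Ψ k R t| ≤ 1 * N := mul_le_mul hs1 (hN R hRI t (hsub ht)) (abs_nonneg _) zero_le_one
    _ = N := one_mul N

/-- **`P_k(R,σ) = −∫₀^σ sin²t·n_k(R,t) dt` on the strip.** [cite: Elgindi2021, §7.1 Proposition 7.1 (p. 19 of arXiv:1904.04795)] -/
theorem pRefl_eq_integral (k : ℕ) {p : ℝ × ℝ} (hp : p ∈ strip) :
    pRefl Ψ k p.1 p.2 = -∫ t in (0:ℝ)..p.2, Real.sin t ^ 2 * nRefl α f Ψ k p.1 t := by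
  obtain ⟨R, σ⟩ := p
  obtain ⟨hR, hσ⟩ : 0 < R ∧ σ ∈ Ioo 0 (π / 2) := ⟨hp.1, hp.2⟩
  simp only
  have ha : 0 < R / 2 := by positivity
  obtain ⟨N, hN0, hN⟩ := h.nRefl_bound k ha (by linarith : R / 2 < 2 * R)
  have hRI : R ∈ Icc (R / 2) (2 * R) := ⟨by linarith, by linarith⟩
  set g : ℝ → ℝ := fun t => -(Real.sin t ^ 2 * nRefl α f Ψ k R t) with hg
  have hgP : ∀ t ∈ Ioo (0:ℝ) (π / 2), dθ (pRefl Ψ k) R t = g t := fun t ht => by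
    rw [h.dθ_pRefl_eq k (p := (R, t)) ⟨hR, ht⟩]; simp only [hg]; ring
  have hgi : IntervalIntegrable g volume 0 σ := (h.intervalIntegrable_sin_sq_nRefl k hR hσ).neg
  -- FTC on `[ε, σ]`
  have hFTC : ∀ ε ∈ Ioo (0:ℝ) σ, pRefl Ψ k R σ - pRefl Ψ k R ε = ∫ t in ε..σ, g t := by
    intro ε hε
    have hsub : uIcc ε σ ⊆ Ioo 0 (π / 2) := by
      rw [uIcc_of_le hε.2.le]; exact fun t ht => ⟨hε.1.trans_le ht.1, ht.2.trans_lt hσ.2⟩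
    have hder : ∀ t ∈ uIcc ε σ, HasDerivAt (fun σ' => pRefl Ψ k R σ') (g t) t := fun t ht => by
      have := h.hasDerivAt_sigma (h.smooth_pRefl k) (p := (R, t)) ⟨hR, hsub ht⟩
      rwa [hgP t (hsub ht)] at this
    have hgi' : IntervalIntegrable g volume ε σ := hgi.mono_set (by
      rw [uIcc_of_le hε.2.le, uIcc_of_le hσ.1.le]; exact Icc_subset_Icc hε.1.le le_rfl)
    exact (integral_eq_sub_of_hasDerivAt hder hgi').symm
  -- let `ε → 0⁺`
  have hlim1 : Tendsto (fun ε => pRefl Ψ k R σ - pRefl Ψ k R ε) (𝓝[>] 0) (𝓝 (pRefl Ψ k R σ - 0)) :=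
    tendsto_const_nhds.sub (h.tendsto_pRefl_zero k hR)
  have hlim2 : Tendsto (fun ε => ∫ t in ε..σ, g t) (𝓝[>] 0) (𝓝 (∫ t in (0:ℝ)..σ, g t)) := by
    -- `∫_ε^σ g = ∫_0^σ g − ∫_0^ε g` and `|∫_0^ε g| ≤ Nε`
    have hsplit : ∀ ε ∈ Ioo (0:ℝ) σ, ∫ t in ε..σ, g t = (∫ t in (0:ℝ)..σ, g t) - ∫ t in (0:ℝ)..ε, g t := by
      intro ε hε
      have h1 : IntervalIntegrable g volume 0 ε := hgi.mono_set (by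
        rw [uIcc_of_le hε.1.le, uIcc_of_le hσ.1.le]; exact Icc_subset_Icc le_rfl hε.2.le)
      have h2 : IntervalIntegrable g volume ε σ := hgi.mono_set (by
        rw [uIcc_of_le hε.2.le, uIcc_of_le hσ.1.le]; exact Icc_subset_Icc hε.1.le le_rfl)
      have := integral_add_adjacent_intervals h1 h2
      linarith
    have hsmall : Tendsto (fun ε => ∫ t in (0:ℝ)..ε, g t) (𝓝[>] 0) (𝓝 0) := by
      have hbound : ∀ ε ∈ Ioo (0:ℝ) σ, |∫ t in (0:ℝ)..ε, g t| ≤ N * |ε - 0| := by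
        intro ε hε
        rw [← Real.norm_eq_abs]
        refine norm_integral_le_of_norm_le_const fun t ht => ?_
        rw [uIoc_of_le hε.1.le] at ht
        have ht' : t ∈ Ioo 0 (π / 2) := ⟨ht.1, ht.2.trans_lt (hε.2.trans hσ.2)⟩
        simp only [hg, Real.norm_eq_abs, abs_neg, abs_mul]
        rw [abs_of_nonneg (sq_nonneg (Real.sin t))]
        have hs1 : Real.sin t ^ 2 ≤ 1 := by nlinarith [Real.sin_sq_add_cos_sq t, sq_nonneg (Real.cos t)]
        calc Real.sin t ^ 2 * |nRefl α f Ψ k R t| ≤ 1 * N := mul_le_mul hs1 (hN R hRI t ht') (abs_nonneg _) zero_le_one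
          _ = N := one_mul N
      rw [← nhdsWithin_Ioo_eq_nhdsGT hσ.1]
      have hmaj : Tendsto (fun ε : ℝ => N * |ε - 0|) (𝓝[Ioo 0 σ] 0) (𝓝 0) := by
        have : Tendsto (fun ε : ℝ => N * |ε - 0|) (𝓝 0) (𝓝 (N * |(0:ℝ) - 0|)) :=
          (continuous_const.mul ((continuous_id.sub continuous_const).abs)).tendsto 0
        rw [sub_self, abs_zero, mul_zero] at this
        exact this.mono_left nhdsWithin_le_nhds
      refine squeeze_zero_norm' ?_ hmaj
      filter_upwards [self_mem_nhdsWithin] with ε hε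
      rw [Real.norm_eq_abs]; exact hbound ε hε
    rw [← nhdsWithin_Ioo_eq_nhdsGT hσ.1] at hsmall ⊢
    have := (tendsto_const_nhds (x := ∫ t in (0:ℝ)..σ, g t)).sub hsmall
    rw [sub_zero] at this
    refine this.congr' ?_
    filter_upwards [self_mem_nhdsWithin] with ε hε
    exact (hsplit ε hε).symm
  have hlim1' : Tendsto (fun ε => pRefl Ψ k R σ - pRefl Ψ k R ε) (𝓝[>] 0) (𝓝 (∫ t in (0:ℝ)..σ, g t)) := by
    rw [← nhdsWithin_Ioo_eq_nhdsGT hσ.1] at hlim2 ⊢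
    refine hlim2.congr' ?_
    filter_upwards [self_mem_nhdsWithin] with ε hε
    exact (hFTC ε hε).symm
  have := tendsto_nhds_unique hlim1 hlim1'
  rw [sub_zero] at this
  rw [this, hg, intervalIntegral.integral_neg]

/-- **`J_k = M₂[r_k]` on the strip** (`r_k = sinc²σ·n_k`). [folklore] -/
theorem jRefl_eq_avgM (k : ℕ) {p : ℝ × ℝ} (hp : p ∈ strip) :
    jRefl Ψ k p.1 p.2 = avgM 2 (rRefl α f Ψ k) p.1 p.2 := by
  obtain ⟨R, σ⟩ := p
  obtain ⟨hR, hσ⟩ : 0 < R ∧ σ ∈ Ioo 0 (π / 2) := ⟨hp.1, hp.2⟩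
  simp only
  have hσ0 : σ ≠ 0 := hσ.1.ne'
  unfold jRefl avgM
  rw [h.pRefl_eq_integral k (p := (R, σ)) hp]
  simp only [neg_neg]
  -- the `avgM` integrand on `(0,1]`: `u² r̃(R,σu) = σ⁻²·sin²(σu)·n(R,σu)`
  have hint : ∫ u in (0:ℝ)..1, u ^ 2 * bext (rRefl α f Ψ k) (R, σ * u) = ∫ u in (0:ℝ)..1, σ⁻¹ ^ 2 * (Real.sin (σ * u) ^ 2 * nRefl α f Ψ k R (σ * u)) := by
    refine integral_congr_ae (ae_of_all _ fun u hu => ?_)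
    rw [uIoc_of_le zero_le_one] at hu
    have hσu : 0 < σ * u := mul_pos hσ.1 hu.1
    rw [bext_of_pos _ (p := (R, σ * u)) hσu]
    show u ^ 2 * (Real.sinc (σ * u) ^ 2 * nRefl α f Ψ k R (σ * u)) = _
    rw [Real.sinc_of_ne_zero hσu.ne']
    have hu0 : u ≠ 0 := hu.1.ne'
    field_simp
  rw [hint, intervalIntegral.integral_const_mul,
    intervalIntegral.integral_comp_mul_left (fun t => Real.sin t ^ 2 * nRefl α f Ψ k R t) hσ0]
  simp only [mul_zero, mul_one, smul_eq_mul]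
  field_simp

/-- **`∂_σz_k = −(σ/sin σ)³·J_k` on the strip.** [folklore] -/
theorem dθ_zRefl_eq_jRefl (k : ℕ) {p : ℝ × ℝ} (hp : p ∈ strip) :
    dθ (zRefl Ψ k) p.1 p.2 = -(p.2 / Real.sin p.2) ^ 3 * jRefl Ψ k p.1 p.2 := by
  have hs : Real.sin p.2 ≠ 0 := (sin_pos_of_mem hp.2).ne'
  have hσ : p.2 ≠ 0 := hp.2.1.ne'
  rw [h.dθ_zRefl_eq k hp]; unfold jRefl; field_simp

/-! ### Uniform bounds for `J_k` and `∂_σz_k` -/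

/-- **`|J_k| ≤ N` and `|∂_σz_k| ≤ (π/2)³N` uniformly on `[a,b] × (0,π/2)`.** [folklore] -/
theorem jRefl_dθ_zRefl_bound (k : ℕ) {a b : ℝ} (ha : 0 < a) (hab : a < b) :
    ∃ K : ℝ, 0 ≤ K ∧ ∀ R ∈ Icc a b, ∀ σ ∈ Ioo 0 (π / 2), |jRefl Ψ k R σ| ≤ K ∧ |dθ (zRefl Ψ k) R σ| ≤ (π / 2) ^ 3 * K := by
  obtain ⟨N, hN0, hN⟩ := h.nRefl_bound k ha hab
  refine ⟨N, hN0, fun R hR σ hσ => ?_⟩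
  have hRpos : 0 < R := ha.trans_le hR.1
  have hp : ((R, σ) : ℝ × ℝ) ∈ strip := ⟨hRpos, hσ⟩
  -- `|P| ≤ N σ³/3 ≤ N σ³`
  have hP : |pRefl Ψ k R σ| ≤ N * σ ^ 3 := by
    rw [h.pRefl_eq_integral k (p := (R, σ)) hp]
    simp only [abs_neg]
    have hle : |∫ t in (0:ℝ)..σ, Real.sin t ^ 2 * nRefl α f Ψ k R t| ≤ ∫ t in (0:ℝ)..σ, N * t ^ 2 := by
      rw [← Real.norm_eq_abs]
      refine norm_integral_le_of_norm_le hσ.1.le (ae_of_all _ fun t ht => ?_) ((by fun_prop : Continuous fun t : ℝ => N * t ^ 2).intervalIntegrable _ _)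
      have ht' : t ∈ Ioo 0 (π / 2) := ⟨ht.1, ht.2.trans_lt hσ.2⟩
      rw [Real.norm_eq_abs, abs_mul, abs_of_nonneg (sq_nonneg (Real.sin t))]
      have hs : Real.sin t ^ 2 ≤ t ^ 2 := pow_le_pow_left₀ (sin_pos_of_mem ht').le (Real.sin_le ht.1.le) 2
      calc Real.sin t ^ 2 * |nRefl α f Ψ k R t| ≤ t ^ 2 * N := mul_le_mul hs (hN R hR t ht') (abs_nonneg _) (sq_nonneg _)
        _ = N * t ^ 2 := mul_comm _ _
    have hev : ∫ t in (0:ℝ)..σ, N * t ^ 2 = N * (σ ^ 3 / 3) := by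
      rw [intervalIntegral.integral_const_mul, integral_pow]; ring
    rw [hev] at hle
    have : N * (σ ^ 3 / 3) ≤ N * σ ^ 3 := by nlinarith [pow_pos hσ.1 3]
    exact hle.trans this
  have hJ : |jRefl Ψ k R σ| ≤ N := by
    unfold jRefl
    rw [abs_div, abs_neg, abs_of_pos (pow_pos hσ.1 3), div_le_iff₀ (pow_pos hσ.1 3)]
    exact hP
  refine ⟨hJ, ?_⟩
  rw [h.dθ_zRefl_eq_jRefl k (p := (R, σ)) hp]
  show |-(σ / Real.sin σ) ^ 3 * jRefl Ψ k R σ| ≤ (π / 2) ^ 3 * N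
  rw [abs_mul, abs_neg, abs_of_nonneg (pow_nonneg (div_nonneg hσ.1.le (sin_pos_of_mem hσ).le) 3)]
  exact mul_le_mul (div_sin_pow_three_le hσ) hJ (abs_nonneg _) (by positivity)

/-! ### Continuity up to `σ = 0` -/

/-- **`w_k` extends (by `0`) jointly continuously to `σ = 0`.** [folklore] -/
theorem extZero_wRefl (k : ℕ) : ExtZero (π / 2) (wRefl Ψ k) := by
  have hπ2 : (0:ℝ) < π / 2 := by positivity
  refine extZero_of_continuousOn hπ2 (g₀ := fun _ => 0) (continuousOn_Ioi_prod_of_local fun a b ha hab => ?_)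
  obtain ⟨S, -, hS⟩ := h.wRefl_rate k ha hab
  have hG : ContinuousOn (uncurry (wRefl Ψ k)) (Ioo a b ×ˢ Ioo 0 (π / 2)) :=
    (h.smooth_wRefl k).continuousOn.mono fun p hp => ⟨ha.trans hp.1.1, hp.2⟩
  have hmd : Tendsto (fun θ => S * Real.sqrt θ) (𝓝[>] 0) (𝓝 0) := by
    have : Tendsto (fun θ => S * Real.sqrt θ) (𝓝 0) (𝓝 (S * Real.sqrt 0)) := (continuous_const.mul Real.continuous_sqrt).tendsto 0
    rw [Real.sqrt_zero, mul_zero] at this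
    exact this.mono_left nhdsWithin_le_nhds
  exact continuousOn_extension (G := wRefl Ψ k) (g₀ := fun _ => 0) hπ2 (fun R hR θ hθ => hS R (Ioo_subset_Icc_self hR) θ hθ) hmd hG

/-- **`n_k` extends jointly continuously to `σ = 0`.** [folklore] -/
theorem extZero_nRefl (k : ℕ) : ExtZero (π / 2) (nRefl α f Ψ k) := by
  have hπ2 : (0:ℝ) < π / 2 := by positivity
  have hd : ExtZero (π / 2) (refl (Dz^[k] f)) := (extZeroUpTo_of_contDiff hπ2 (h.smooth_refl_datum k) 0).zero
  have h1 := ((h.extZero_wRefl k).const_mul hπ2 4).add hπ2 hd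
  have h2 := ((h.extZero_wRefl (k + 2)).sub hπ2 (h.extZero_wRefl (k + 1))).const_mul hπ2 (α ^ 2)
  have h3 := (h.extZero_wRefl (k + 1)).const_mul hπ2 (α * (5 + α))
  exact (h1.add hπ2 h2).add hπ2 h3

/-- **`r_k = sinc²·n_k` extends jointly continuously to `σ = 0`.** [folklore] -/
theorem extZero_rRefl (k : ℕ) : ExtZero (π / 2) (rRefl α f Ψ k) :=
  ExtZero.coef_mul (by positivity) (μ := fun _ σ => Real.sinc σ ^ 2)
    ((Real.continuous_sinc.pow 2).comp continuous_snd).continuousOn (h.extZero_nRefl k)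

/-- **`J_k` extends jointly continuously to `σ = 0`** (it is `M₂[r_k]` on the strip). [folklore] -/
theorem extZero_jRefl (k : ℕ) : ExtZero (π / 2) (jRefl Ψ k) :=
  (extZero_congr le_rfl (fun p hp => h.jRefl_eq_avgM k hp)).2 (extZero_avgM (by positivity) 2 (h.extZero_rRefl k))

/-- `1/sinc³` is continuous on the slab (`sinc ≠ 0` on `[0, π/2)`). [folklore] -/
theorem continuousOn_inv_sinc_cube : ContinuousOn (fun p : ℝ × ℝ => (1 / Real.sinc p.2) ^ 3) (Ioi 0 ×ˢ Ico 0 (π / 2)) := by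
  have := h
  have hsinc : ∀ p ∈ Ioi (0:ℝ) ×ˢ Ico (0:ℝ) (π / 2), Real.sinc p.2 ≠ 0 := by
    intro p hp
    rcases hp.2.1.lt_or_eq with hpos | hzero
    · rw [Real.sinc_of_ne_zero hpos.ne']
      exact div_ne_zero (sin_pos_of_mem ⟨hpos, hp.2.2⟩).ne' hpos.ne'
    · rw [← hzero, Real.sinc_zero]; exact one_ne_zero
  exact (continuousOn_const.div ((Real.continuous_sinc.comp continuous_snd).continuousOn) hsinc).pow 3

/-- `∂_σz_k = −(1/sinc σ)³·J_k` on the strip. [folklore] -/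
theorem dθ_zRefl_eq_sinc (k : ℕ) {p : ℝ × ℝ} (hp : p ∈ strip) :
    dθ (zRefl Ψ k) p.1 p.2 = -(1 / Real.sinc p.2) ^ 3 * jRefl Ψ k p.1 p.2 := by
  rw [h.dθ_zRefl_eq_jRefl k hp, Real.sinc_of_ne_zero hp.2.1.ne']
  have hs : Real.sin p.2 ≠ 0 := (sin_pos_of_mem hp.2).ne'
  have hσ : p.2 ≠ 0 := hp.2.1.ne'
  field_simp

/-- **`∂_σz_k` extends jointly continuously to `σ = 0`.** [folklore] -/
theorem extZero_dθ_zRefl (k : ℕ) : ExtZero (π / 2) (dθ (zRefl Ψ k)) :=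
  (extZero_congr le_rfl (fun p hp => h.dθ_zRefl_eq_sinc k hp)).2
    (ExtZero.coef_mul (by positivity) (μ := fun _ σ => -(1 / Real.sinc σ) ^ 3)
      (h.continuousOn_inv_sinc_cube.neg) (h.extZero_jRefl k))

/-- **`z_k = V_k/cos θ` extends jointly continuously to `σ = 0`** (`∂_σz_k` is bounded, so the
slices are uniformly Lipschitz). [cite: Elgindi2021, §7.1 Proposition 7.1 (p. 19 of arXiv:1904.04795)] -/
theorem extZero_zRefl (k : ℕ) : ExtZero (π / 2) (zRefl Ψ k) := by
  have hπ2 : (0:ℝ) < π / 2 := by positivity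
  refine extZero_of_continuousOn hπ2 (g₀ := fun R => limUnder (𝓝[>] (0:ℝ)) fun σ => zRefl Ψ k R σ)
    (continuousOn_Ioi_prod_of_local fun a b ha hab => ?_)
  obtain ⟨K, hK0, hK⟩ := h.jRefl_dθ_zRefl_bound k ha hab
  set K' := (π / 2) ^ 3 * K
  have hG : ContinuousOn (uncurry (zRefl Ψ k)) (Ioo a b ×ˢ Ioo 0 (π / 2)) :=
    (h.smooth_zRefl k).continuousOn.mono fun p hp => ⟨ha.trans hp.1.1, hp.2⟩
  -- slices: derivative bounded by `K'`, hence `L²`, limit exists, Hölder modulus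
  have hslice : ∀ R ∈ Icc a b,
      Tendsto (fun σ => zRefl Ψ k R σ) (𝓝[>] 0) (𝓝 (limUnder (𝓝[>] (0:ℝ)) fun σ => zRefl Ψ k R σ)) ∧
      ∀ σ₁ σ₂, σ₁ ∈ Ioo (0:ℝ) (π / 2) → σ₂ ∈ Ioo (0:ℝ) (π / 2) → σ₁ ≤ σ₂ →
        |zRefl Ψ k R σ₂ - zRefl Ψ k R σ₁| ≤ K' * Real.sqrt (π / 2) * Real.sqrt (σ₂ - σ₁) := by
    intro R hR
    have hRpos : 0 < R := ha.trans_le hR.1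
    have hy : ∀ σ ∈ Ioo (0:ℝ) (π / 2), HasDerivAt (fun σ' => zRefl Ψ k R σ') (dθ (zRefl Ψ k) R σ) σ := fun σ hσ =>
      h.hasDerivAt_sigma (h.smooth_zRefl k) (p := (R, σ)) ⟨hRpos, hσ⟩
    have hy'c : ContinuousOn (fun σ => dθ (zRefl Ψ k) R σ) (Ioo 0 (π / 2)) :=
      h.continuousOn_theta_slice (contDiffOn_dθ_strip (h.smooth_zRefl k)) hRpos
    have hbd : ∀ σ ∈ Ioo (0:ℝ) (π / 2), |dθ (zRefl Ψ k) R σ| ≤ K' := fun σ hσ => (hK R hR σ hσ).2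
    have hI : IntegrableOn (fun σ => dθ (zRefl Ψ k) R σ ^ 2) (Ioo 0 (π / 2)) := by
      have ic : IntegrableOn (fun _ : ℝ => K' ^ 2) (Ioo 0 (π / 2)) volume := integrableOn_const (by simp)
      refine Integrable.mono' ic ((hy'c.pow 2).aestronglyMeasurable measurableSet_Ioo) ?_
      rw [ae_restrict_iff' measurableSet_Ioo]
      refine ae_of_all _ fun σ hσ => ?_
      rw [Real.norm_eq_abs, abs_of_nonneg (sq_nonneg _), ← sq_abs]
      exact pow_le_pow_left₀ (abs_nonneg _) (hbd σ hσ) 2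
    have hIle : ∫ σ in Ioo 0 (π / 2), dθ (zRefl Ψ k) R σ ^ 2 ≤ K' ^ 2 * (π / 2) := by
      have ic : IntegrableOn (fun _ : ℝ => K' ^ 2) (Ioo 0 (π / 2)) volume := integrableOn_const (by simp)
      have := setIntegral_mono_on hI ic measurableSet_Ioo fun σ hσ => by
        show dθ (zRefl Ψ k) R σ ^ 2 ≤ K' ^ 2
        rw [← sq_abs]; exact pow_le_pow_left₀ (abs_nonneg _) (hbd σ hσ) 2
      rwa [setIntegral_const, smul_eq_mul, measureReal_def, Real.volume_Ioo, sub_zero, ENNReal.toReal_ofReal hπ2.le, mul_comm] at this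
    obtain ⟨-, ⟨L, hL⟩⟩ := exists_tendsto_of_sq_integrable_deriv hπ2 hy hy'c hI
    refine ⟨tendsto_nhds_limUnder ⟨L, hL⟩, fun σ₁ σ₂ h₁ h₂ h12 => ?_⟩
    have hsq := sq_sub_le_mul_integral hy hy'c hI h₁ h₂ h12
    have : (zRefl Ψ k R σ₂ - zRefl Ψ k R σ₁) ^ 2 ≤ (K' * Real.sqrt (π / 2) * Real.sqrt (σ₂ - σ₁)) ^ 2 := by
      rw [mul_pow, mul_pow, Real.sq_sqrt hπ2.le, Real.sq_sqrt (by linarith)]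
      nlinarith [hIle, sub_nonneg.2 h12, sq_nonneg K']
    exact abs_le_of_sq_le_sq this (by positivity)
  have hrate : ∀ R ∈ Ioo a b, ∀ σ ∈ Ioo (0:ℝ) (π / 2),
      |zRefl Ψ k R σ - limUnder (𝓝[>] (0:ℝ)) (fun σ => zRefl Ψ k R σ)| ≤ K' * Real.sqrt (π / 2) * Real.sqrt σ := by
    intro R hR σ hσ
    obtain ⟨hlim, hH⟩ := hslice R (Ioo_subset_Icc_self hR)
    exact abs_sub_lim_le_of_holder hH hlim hσ
  have hmd : Tendsto (fun θ => K' * Real.sqrt (π / 2) * Real.sqrt θ) (𝓝[>] 0) (𝓝 0) := by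
    have : Tendsto (fun θ => K' * Real.sqrt (π / 2) * Real.sqrt θ) (𝓝 0) (𝓝 (K' * Real.sqrt (π / 2) * Real.sqrt 0)) :=
      (continuous_const.mul Real.continuous_sqrt).tendsto 0
    rw [Real.sqrt_zero, mul_zero] at this
    exact this.mono_left nhdsWithin_le_nhds
  exact continuousOn_extension (G := zRefl Ψ k) hπ2 hrate hmd hG

end TangentialFamily

end Elgindi

end Literature.Analysis.FluidPDE
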